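import Mathlib.RingTheory.Derivation.Basic
import Mathlib.Algebra.MvPolynomial.PDeriv
import Mathlib.Algebra.MvPolynomial.Derivation
import Mathlib.RingTheory.Ideal.Operations
import HarnessLib

/-!
# Ideals of derivatives `𝒟(𝓘)`, `𝒟ⁱ(𝓘)` (BGMW 2011, Def. 3.5.1) — ring level

Topic: `Literature/AlgebraicGeometry/Resolution`. Bierstone–Grigoriev–Milman–Włodarczyk, *Effective
Hironaka resolution and its complexity*, arXiv:1206.3090, §3.5, Def. 3.5.1 (Giraud, Villamayor):
"By the first derivative `𝒟(𝓘)` of `𝓘` we mean the coherent sheaf of ideals generated by all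
functions `f ∈ 𝓘` together with their first derivatives. Then the `i`-th derivative `𝒟ⁱ(𝓘)` is
defined to be `𝒟(𝒟^{i-1}(𝓘))`. If `(𝓘, μ)` is a marked ideal and `i ≤ μ` then we define
`𝒟ⁱ(𝓘, μ) := (𝒟ⁱ(𝓘), μ - i)`." Here at the level of an `R`-algebra `A` (the sections over an
affine open of a smooth `R = K`-variety; `Der_K(𝒪_X)` is "locally generated by the derivations
`∂/∂uᵢ`"), with the sheaf version left to a later file:

* `derivIdeal R I = 𝒟(I)` — the ideal generated by `I` and all `δ f`, `δ ∈ Der_R(A, A)`, `f ∈ I`;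
  `le_derivIdeal`, `apply_mem_derivIdeal`, `derivIdeal_le_iff`, `derivIdeal_mono`,
  `derivIdeal_top`, `derivIdeal_bot`;
* `derivIdealIter R i I = 𝒟ⁱ(I)` (iteration); `derivIdealIter_succ`, `le_derivIdealIter`,
  `derivIdealIter_mono`, `derivIdealIter_le_derivIdealIter` (increasing in `i`);
* `Derivation.apply_mem_pow_sub_one` — **Leibniz: `δ(Pⁿ) ⊆ Pⁿ⁻¹`**; hence
  `derivIdeal_le_pow_sub_one`, `derivIdealIter_le_pow_sub` — `I ⊆ Pⁿ ⇒ 𝒟ⁱ(I) ⊆ Pⁿ⁻ⁱ`, the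
  inclusion `supp(𝓘, μ) ⊆ supp(𝒟ⁱ(𝓘), μ - i)` of BGMW Lemma 3.5.2 in ring form, valid in every
  characteristic (the reverse inclusion is where `μ < char` enters, BGMW §8) — PROVED;
* `MvPolynomial.derivation_apply_eq_sum` — on `R[x_1, …, x_n]` every `R`-derivation is
  `δ = Σᵢ δ(xᵢ) ∂/∂xᵢ`; `derivIdeal_mvPolynomial` — **`𝒟(I) = I + (∂f/∂xᵢ : f ∈ I, i)`**, BGMW's
  "defined locally by generators `f_j` of `𝓘` and all their partial derivatives" — PROVED.

## Sources

* [BGMW 2011] §3.5, Def. 3.5.1 and the paragraph after it; Lemma 3.5.2 (p. 7, arXiv numbering).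
  [BierstoneGrigorievMilmanWlodarczyk2011]
-/

namespace Literature.AlgebraicGeometry.Resolution

open MvPolynomial

section General

variable (R : Type*) {A : Type*} [CommSemiring R] [CommRing A] [Algebra R A]

/-- **The ideal of first derivatives `𝒟(I)`** (BGMW Def. 3.5.1, after Giraud and Villamayor),
at the level of an `R`-algebra `A`: the ideal generated by the elements of `I` together with all
their first derivatives `δ f`, `δ` an `R`-derivation of `A`, `f ∈ I`.
[cite: BierstoneGrigorievMilmanWlodarczyk2011, Def. 3.5.1] -/
def derivIdeal (I : Ideal A) : Ideal A :=
  I ⊔ Ideal.span {x | ∃ (δ : Derivation R A A) (f : A), f ∈ I ∧ δ f = x}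

/-- `I ⊆ 𝒟(I)`. [cite: BierstoneGrigorievMilmanWlodarczyk2011, Def. 3.5.1] -/
theorem le_derivIdeal (I : Ideal A) : I ≤ derivIdeal R I :=
  le_sup_left

/-- First derivatives of elements of `I` lie in `𝒟(I)`. [cite: BierstoneGrigorievMilmanWlodarczyk2011, Def. 3.5.1] -/
theorem apply_mem_derivIdeal (δ : Derivation R A A) {I : Ideal A} {f : A} (hf : f ∈ I) :
    δ f ∈ derivIdeal R I :=
  Ideal.mem_sup_right (Ideal.subset_span ⟨δ, f, hf, rfl⟩)

/-- `𝒟(I) ⊆ J` iff `I ⊆ J` and `J` contains all first derivatives of elements of `I`. [folklore] -/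
theorem derivIdeal_le_iff {I J : Ideal A} :
    derivIdeal R I ≤ J ↔ I ≤ J ∧ ∀ (δ : Derivation R A A), ∀ f ∈ I, δ f ∈ J := by
  constructor
  · intro h
    exact ⟨(le_derivIdeal R I).trans h, fun δ f hf => h (apply_mem_derivIdeal R δ hf)⟩
  · rintro ⟨h1, h2⟩
    refine sup_le h1 (Ideal.span_le.mpr ?_)
    rintro _ ⟨δ, f, hf, rfl⟩
    exact h2 δ f hf

/-- `𝒟` is monotone. [folklore] -/
theorem derivIdeal_mono {I J : Ideal A} (h : I ≤ J) : derivIdeal R I ≤ derivIdeal R J :=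
  (derivIdeal_le_iff R).mpr ⟨h.trans (le_derivIdeal R J), fun δ _ hf => apply_mem_derivIdeal R δ (h hf)⟩

/-- `𝒟(A) = A`. [folklore] -/
theorem derivIdeal_top : derivIdeal R (⊤ : Ideal A) = ⊤ :=
  top_le_iff.mp (le_derivIdeal R ⊤)

/-- `𝒟(0) = 0`. [folklore] -/
theorem derivIdeal_bot : derivIdeal R (⊥ : Ideal A) = ⊥ := by
  refine le_bot_iff.mp ((derivIdeal_le_iff R).mpr ⟨le_rfl, fun δ f hf => ?_⟩)
  rw [Ideal.mem_bot] at hf ⊢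
  rw [hf, map_zero]

/-- **The higher derivatives `𝒟ⁱ(I) := 𝒟(𝒟^{i-1}(I))`** (BGMW Def. 3.5.1).
[cite: BierstoneGrigorievMilmanWlodarczyk2011, Def. 3.5.1] -/
def derivIdealIter (i : ℕ) (I : Ideal A) : Ideal A :=
  (derivIdeal R)^[i] I

/-- `𝒟⁰(I) = I`. [folklore] -/
@[simp] theorem derivIdealIter_zero (I : Ideal A) : derivIdealIter R 0 I = I := rfl

/-- `𝒟^{i+1}(I) = 𝒟(𝒟ⁱ(I))`. [cite: BierstoneGrigorievMilmanWlodarczyk2011, Def. 3.5.1] -/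
theorem derivIdealIter_succ (i : ℕ) (I : Ideal A) :
    derivIdealIter R (i + 1) I = derivIdeal R (derivIdealIter R i I) :=
  Function.iterate_succ_apply' _ _ _

/-- `𝒟¹ = 𝒟`. [folklore] -/
@[simp] theorem derivIdealIter_one (I : Ideal A) : derivIdealIter R 1 I = derivIdeal R I := rfl

/-- `𝒟ⁱ` is monotone in the ideal. [folklore] -/
theorem derivIdealIter_mono (i : ℕ) {I J : Ideal A} (h : I ≤ J) :
    derivIdealIter R i I ≤ derivIdealIter R i J := by
  induction i with
  | zero => exact h
  | succ i ih =>
    rw [derivIdealIter_succ, derivIdealIter_succ]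
    exact derivIdeal_mono R ih

/-- `I ⊆ 𝒟ⁱ(I)`. [folklore] -/
theorem le_derivIdealIter (i : ℕ) (I : Ideal A) : I ≤ derivIdealIter R i I := by
  induction i with
  | zero => exact le_rfl
  | succ i ih =>
    rw [derivIdealIter_succ]
    exact ih.trans (le_derivIdeal R _)

/-- The chain `I ⊆ 𝒟(I) ⊆ 𝒟²(I) ⊆ ⋯` is increasing. [folklore] -/
theorem derivIdealIter_le_derivIdealIter {i j : ℕ} (h : i ≤ j) (I : Ideal A) :
    derivIdealIter R i I ≤ derivIdealIter R j I := by
  obtain ⟨k, rfl⟩ := Nat.exists_eq_add_of_le h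
  show (derivIdeal R)^[i] I ≤ (derivIdeal R)^[i + k] I
  rw [add_comm, Function.iterate_add_apply]
  exact le_derivIdealIter R k _

/-- **The marked derivative** `𝒟ⁱ(𝓘, μ) := (𝒟ⁱ(𝓘), μ - i)` (BGMW Def. 3.5.1, for `i ≤ μ`), on
pairs (ideal, multiplicity). [cite: BierstoneGrigorievMilmanWlodarczyk2011, Def. 3.5.1] -/
def derivMarked (i : ℕ) (Iμ : Ideal A × ℕ) : Ideal A × ℕ :=
  (derivIdealIter R i Iμ.1, Iμ.2 - i)

/-- Unfolding `derivMarked`. [folklore] -/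
@[simp] theorem derivMarked_fst (i : ℕ) (Iμ : Ideal A × ℕ) :
    (derivMarked R i Iμ).1 = derivIdealIter R i Iμ.1 := rfl

/-- Unfolding `derivMarked`. [folklore] -/
@[simp] theorem derivMarked_snd (i : ℕ) (Iμ : Ideal A × ℕ) : (derivMarked R i Iμ).2 = Iμ.2 - i := rfl

/-! ## Derivatives lower the order by at most one: `δ(Pⁿ) ⊆ Pⁿ⁻¹` -/

/-- **Leibniz rule for powers of ideals**: a derivation maps `Pⁿ` into `Pⁿ⁻¹`. [folklore] -/
theorem Derivation.apply_mem_pow_sub_one (δ : Derivation R A A) (P : Ideal A) :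
    ∀ (n : ℕ) {f : A}, f ∈ P ^ n → δ f ∈ P ^ (n - 1) := by
  intro n
  induction n with
  | zero => intro f _; simp
  | succ n ih =>
    intro f hf
    rw [Nat.add_sub_cancel]
    rw [pow_succ'] at hf
    refine Submodule.mul_induction_on hf (fun a ha b hb => ?_) (fun x y hx hy => ?_)
    · -- `δ(ab) = a δb + b δa` with `a ∈ P`, `b ∈ Pⁿ`
      rw [Derivation.leibniz, smul_eq_mul, smul_eq_mul]
      refine Ideal.add_mem _ ?_ (Ideal.mul_mem_right _ _ hb)
      cases n with
      | zero => simp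
      | succ m =>
        have hb' : δ b ∈ P ^ m := by simpa using ih hb
        rw [pow_succ']
        exact Ideal.mul_mem_mul ha hb'
    · rw [map_add]
      exact Ideal.add_mem _ hx hy

/-- `I ⊆ Pⁿ ⇒ 𝒟(I) ⊆ Pⁿ⁻¹`. [cite: BierstoneGrigorievMilmanWlodarczyk2011, Lemma 3.5.2] -/
theorem derivIdeal_le_pow_sub_one {I P : Ideal A} {n : ℕ} (h : I ≤ P ^ n) :
    derivIdeal R I ≤ P ^ (n - 1) :=
  (derivIdeal_le_iff R).mpr ⟨h.trans (Ideal.pow_le_pow_right (Nat.sub_le n 1)),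
    fun δ _ hf => Derivation.apply_mem_pow_sub_one R δ P n (h hf)⟩

/-- **BGMW Lemma 3.5.2, the inclusion `supp(𝓘, μ) ⊆ supp(𝒟ⁱ(𝓘), μ - i)` in ring form** (valid
in every characteristic): `I ⊆ Pⁿ ⇒ 𝒟ⁱ(I) ⊆ Pⁿ⁻ⁱ` (apply at `P = 𝔪_x`: `ord_x 𝓘 ≥ μ ⇒
ord_x 𝒟ⁱ(𝓘) ≥ μ - i`). [cite: BierstoneGrigorievMilmanWlodarczyk2011, Lemma 3.5.2] -/
theorem derivIdealIter_le_pow_sub {I P : Ideal A} {n : ℕ} (h : I ≤ P ^ n) (i : ℕ) :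
    derivIdealIter R i I ≤ P ^ (n - i) := by
  induction i with
  | zero => simpa using h
  | succ i ih =>
    rw [derivIdealIter_succ, Nat.sub_succ]
    exact derivIdeal_le_pow_sub_one R ih

end General

/-! ## Polynomial rings: `𝒟(I)` is generated by `I` and the partial derivatives -/

section Polynomial

variable (R : Type*) [CommRing R] {σ : Type*} [Fintype σ]

/-- On `R[x_i : i ∈ σ]` (`σ` finite) every `R`-derivation is `δ = Σᵢ δ(xᵢ) · ∂/∂xᵢ`
("The dual sheaf of derivations is locally generated by the derivations `∂/∂uᵢ`").
[cite: BierstoneGrigorievMilmanWlodarczyk2011, §3.5] -/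
theorem MvPolynomial.derivation_apply_eq_sum
    (δ : Derivation R (MvPolynomial σ R) (MvPolynomial σ R)) (f : MvPolynomial σ R) :
    δ f = ∑ i, δ (X i) * pderiv i f := by
  classical
  -- evaluation of a sum of derivations
  have hsum : ∀ g : MvPolynomial σ R,
      (∑ i, δ (X i) • (pderiv i : Derivation R (MvPolynomial σ R) (MvPolynomial σ R))) g =
        ∑ i, δ (X i) * pderiv i g := by
    intro g
    rw [← Derivation.coeFnAddMonoidHom_apply, map_sum, Finset.sum_apply]
    refine Finset.sum_congr rfl fun i _ => ?_
    rw [Derivation.coeFnAddMonoidHom_apply, Derivation.smul_apply, smul_eq_mul]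
  have key : δ = ∑ i, δ (X i) • (pderiv i : Derivation R (MvPolynomial σ R) (MvPolynomial σ R)) := by
    refine MvPolynomial.derivation_ext fun j => ?_
    rw [hsum, Finset.sum_eq_single j]
    · rw [pderiv_X_self, mul_one]
    · intro i _ hij
      rw [pderiv_X_of_ne hij.symm, mul_zero]
    · intro hj
      exact absurd (Finset.mem_univ j) hj
  conv_lhs => rw [key]
  exact hsum f

/-- **`𝒟(I) = I + (∂f/∂xᵢ : f ∈ I)` on a polynomial ring** (BGMW: "`𝒟(𝓘)` is a coherent sheaf
defined locally by generators `f_j` of `𝓘` and all their partial derivatives `∂f_j/∂uᵢ`"; here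
with all `f ∈ I`). [cite: BierstoneGrigorievMilmanWlodarczyk2011, §3.5 after Def. 3.5.1] -/
theorem derivIdeal_mvPolynomial (I : Ideal (MvPolynomial σ R)) :
    derivIdeal R I = I ⊔ Ideal.span {x | ∃ (i : σ) (f : MvPolynomial σ R), f ∈ I ∧ pderiv i f = x} := by
  apply le_antisymm
  · refine (derivIdeal_le_iff R).mpr ⟨le_sup_left, fun δ f hf => ?_⟩
    rw [MvPolynomial.derivation_apply_eq_sum]
    refine Submodule.sum_mem _ fun i _ => Ideal.mul_mem_left _ _ ?_
    exact Ideal.mem_sup_right (Ideal.subset_span ⟨i, f, hf, rfl⟩)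
  · refine sup_le (le_derivIdeal R I) (Ideal.span_le.mpr ?_)
    rintro _ ⟨i, f, hf, rfl⟩
    exact apply_mem_derivIdeal R (pderiv i) hf

omit [Fintype σ] in
/-- In particular the partial derivatives of elements of `I` lie in `𝒟(I)`. [folklore] -/
theorem pderiv_mem_derivIdeal {I : Ideal (MvPolynomial σ R)} (i : σ) {f : MvPolynomial σ R}
    (hf : f ∈ I) : pderiv i f ∈ derivIdeal R I :=
  apply_mem_derivIdeal R (pderiv i) hf

end Polynomial

end Literature.AlgebraicGeometry.Resolution
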